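import Summits.AtomisticToContinuum.Crystallization.Theorems.ChartedZeroExcessLayeredLatticeLiouvilleZO

/-!
# Part ZP «(L2-C) decided in the parallel case: pieces and junction» (lens-2 g79, NODE 79 — part 3b)

NODE 79 (structural dichotomy special / generic on the open piece (L2-C) `CoolShadowLinearChartP` of NODE 78):

  (L2-C)(R₁, RC, η)  ⟺  (L2-C∥) PARALLEL case `CoolShadowLinearChartParallelP` [PROVED here, `coolShadowLinearChart_parallel`]
                      ∧ (L2-C∦) THE REST `CoolShadowLinearChartRestP` [open, WEAKER: the complement case]
  (`coolShadowLinearChartP_iff_parallel_rest` — the EQUIV layer), and beneath it the refinement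
  (L2-C∦)  ⟺  (L2-C⟂) OBLIQUE case `CoolShadowLinearChartObliqueP` (`K ≠ ∅`, registration not parallel) [open]
            ∧ (L2-C∅) EMPTY-CONTAINER corner `CoolShadowLinearChartEmptyP` (`K = ∅`: (GL) is vacuous there, (L2-C) is not) [open]
  (`rest_iff_oblique_empty`),

where the case split is on `IsParallelReg`: the registration of the cool shadow crystal (in ITS GIVEN parametrisation `L', w', U, t`, skeleton
`placedSkel`) to the charted door set is PARALLEL on the moat — an injective map `σ` of chart sheets to skeleton layers.  The parallel case is decided
by parts ZM–ZO at EVERY radius `RC` with `RC + 2ε + (17/16 + 2ϑr) + q < ℓ` (Barlow neighbours of atoms registered to ball sites must be registered);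
at the record numerics this is `RC < 16.4369`, short of the record `RC = 33/2` of NODE 78 — so the junction of part ZK is RE-INSTANCED at `RC' = 821/50`
(`bondLabelP_record_of_rest`: (GL) ⟸ (L2-S)(14, 57/4, 82/5) ∧ (L2-C∦)(82/5, 821/50, 1/100), equivalently `bondLabelP_record_of_cases` with
(L2-C⟂) ∧ (L2-C∅); the general junction `bondLabelP_of_pinning_linearChart` only needs `R₁ + ε ≤ RC`), and (L2-C) is MONOTONE in `(RC, η)`
(`coolShadowLinearChartP_mono`), so the record (L2-C)(82/5, 33/2, 1/100) of NODE 78 implies the weaker (L2-C)(82/5, 821/50, 1/100) used now.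
These are the junctions AT THE LEVEL OF (L2-C); the junction OF RECORD of NODE 79 is in the sequel ZQ, which observes that (GL) is vacuous at
`K = ∅`, so that only (L2-C⟂) remains open there (`bondLabelP_record_of_oblique`) — the pieces (L2-C∦) and (L2-C∅) of this file are (L2-C)-level
bookkeeping, not pieces of record.

0 sorry; standard axioms.
-/

noncomputable section
open scoped BigOperators Classical InnerProductSpace RealInnerProductSpace
open MeasureTheory Set Metric Filter Topology
open Summit.AtomisticToContinuum.Crystallization.Theorems.ChartedPlanarOrderRigidityDoor (E3 IsClean IsCharted)
open Summit.AtomisticToContinuum.Crystallization.Theorems.ChartedPlanarOrderDensityDichotomy (μS IsSep)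
open Summit.AtomisticToContinuum.Crystallization.Theorems.ChartedPlanarOrderCleanScaleP (IsCleanP IsDoorSetP isCleanP_one_iff isCleanP_μS_iff)
open Summit.AtomisticToContinuum.Crystallization.Theorems.ChartedPlanarOrderMesoCut (LayeredHom EnvClose)
open Summit.AtomisticToContinuum.Crystallization.Theorems.ChartedPlanarOrderDoorLayeredOsc (IsTwoShellAffineGood mem_iff_μS_singleton_ne_zero)
open Literature.MathematicalPhysics.StatisticalMechanics (lennardJones triangularVec₁ triangularVec₂)
open Literature.Geometry.DiscreteGeometry (IsTwoShellGoodSet)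

namespace Summit.AtomisticToContinuum.Crystallization.Theorems.ChartedZeroExcessLayeredLatticeLiouville

/-! ### ZP-1  The parallel registration predicate and the case pieces -/

/-- the linear SKELETON of the placed crystal in its given parametrisation: `y ↦ U⁻¹ (L' (y.2.1 t₁ + y.2.2 t₂) + w' y.1) + t`. -/
def placedSkel (L' : E3 →L[ℝ] E3) (w' : ℤ → E3) (U : E3 ≃ₗᵢ[ℝ] E3) (t : E3) : ℤ × ℤ × ℤ → E3 :=
  linChart (fun m => U.symm (w' m) + t) (U.symm (L' (triangularVec₁ 1))) (U.symm (L' (triangularVec₂ 1)))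

/-- the placed crystal is the range of its skeleton. [formal bookkeeping] -/
theorem placedCrystal_eq_range_placedSkel (L' : E3 →L[ℝ] E3) (w' : ℤ → E3) (U : E3 ≃ₗᵢ[ℝ] E3) (t : E3) :
    placedCrystal L' w' U t = Set.range (placedSkel L' w' U t) :=
  placedCrystal_eq_range_linChart L' w' U t

/-- ★ **PARALLEL REGISTRATION** of the cool shadow crystal `(L', w', U, t)` to the chart `Ψ` of the door set on the moat `moatIn S K r ℓ`: an INJECTIVE
map `σ` of chart sheets to skeleton layers such that every skeleton representative of a crystal site within `ε` of a moat atom of sheet `s` has layer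
index `σ s` (the registered crystal planes are the registered close-packed planes of `S`, sheet by sheet). -/
def IsParallelReg (ε r ℓ : ℝ) (S K : Set E3) (Ψ : ℤ × ℤ × ℤ → E3) (L' : E3 →L[ℝ] E3) (w' : ℤ → E3) (U : E3 ≃ₗᵢ[ℝ] E3) (t : E3) : Prop :=
  ∃ σ : ℤ → ℤ, Function.Injective σ ∧ ∀ x, Ψ x ∈ moatIn S K r ℓ → ∀ y, dist (Ψ x) (placedSkel L' w' U t y) ≤ ε → y.1 = σ x.1

/-- the CONCLUSION of (L2-C) for one configuration: an `η`-linear exact Barlow chart of the crystal on the `RC`-ball, onto, sheet-compatible within `R₁`. -/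
def LinChartConcl (ε r ℓ R₁ RC η : ℝ) (S K : Set E3) (x₀ : E3) (Ψ : ℤ × ℤ × ℤ → E3) (L' : E3 →L[ℝ] E3) (w' : ℤ → E3) (U : E3 ≃ₗᵢ[ℝ] E3)
    (t : E3) : Prop :=
  ∃ (Ψ' : ℤ × ℤ × ℤ → E3) (o : ℤ → E3) (b₁ b₂ : E3) (τ' : ℤ → Bool),
    IsBarlowBondChart (placedCrystal L' w' U t) {y | dist (Ψ' y) x₀ ≤ RC} Ψ' τ' ∧
    (∀ c ∈ placedCrystal L' w' U t, dist c x₀ ≤ RC → ∃ y, Ψ' y = c) ∧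
    (∀ x, Ψ x ∈ moatIn S K r ℓ → dist (Ψ x) x₀ ≤ R₁ → ∀ y, dist (Ψ' y) x₀ ≤ RC → dist (Ψ x) (Ψ' y) ≤ ε → y.1 = x.1) ∧
    (∀ y, dist (Ψ' y) (linChart o b₁ b₂ y) ≤ η)

/-- (L2-C) RESTRICTED TO A CASE `P` of the data `(S, K, Ψ, L', w', U, t)` — the binders of `CoolShadowLinearChartP` verbatim, then `P`, then its conclusion. -/
def CoolShadowLinearChartUnderP
    (P : Set E3 → Set E3 → (ℤ × ℤ × ℤ → E3) → (E3 →L[ℝ] E3) → (ℤ → E3) → (E3 ≃ₗᵢ[ℝ] E3) → E3 → Prop)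
    (ϑc ϑp r q rsh rm σ ϑr Rs ε rI ℓ aHi Λ θ s R₁ RC η : ℝ) : Prop :=
  ∀ δ : ℝ, 0 < δ → ∀ a : ℝ, 0 < a →
    ∀ S : Set E3, IsDoorSetP aHi δ S → (∀ z : E3, Summable fun y : S => lennardJones (dist z (y : E3))) →
      (∀ p ∈ S, IsTwoShellAffineGood θ S p) →
        ∀ (L : E3 ≃L[ℝ] E3) (w : ℤ → E3), IsEquilChart a s Λ L w →
          ∀ (x₀ : E3) (K : Set E3), K ⊆ S → (∀ k ∈ K, dist k x₀ ≤ q) →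
            IsTameOn ϑp S (LayeredHom (L : E3 →L[ℝ] E3) w) (coreOf S K rm) →
              IsTameOn ϑc S (LayeredHom (L : E3 →L[ℝ] E3) w) (moatIn S K r (r + rsh)) →
                ∀ (L' : E3 →L[ℝ] E3) (w' : ℤ → E3) (U : E3 ≃ₗᵢ[ℝ] E3) (t : E3),
                  IsCoolShadowCrystal σ ϑr Rs ε r rI ℓ S K (LayeredHom (L : E3 →L[ℝ] E3) w) L' w' U t →
                    ∀ (Ψ : ℤ × ℤ × ℤ → E3) (τ : ℤ → Bool), IsBarlowBondChart S Set.univ Ψ τ → (∀ p ∈ S, ∃ x, Ψ x = p) →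
                      P S K Ψ L' w' U t → LinChartConcl ε r ℓ R₁ RC η S K x₀ Ψ L' w' U t

/-- ★ (L2-C∥) THE PARALLEL CASE: non-empty container, parallel registration. -/
def CoolShadowLinearChartParallelP (ϑc ϑp r q rsh rm σ ϑr Rs ε rI ℓ aHi Λ θ s R₁ RC η : ℝ) : Prop :=
  CoolShadowLinearChartUnderP (fun S K Ψ L' w' U t => K.Nonempty ∧ IsParallelReg ε r ℓ S K Ψ L' w' U t)
    ϑc ϑp r q rsh rm σ ϑr Rs ε rI ℓ aHi Λ θ s R₁ RC η

/-- ★ (L2-C∦) THE REST [open]: every configuration NOT in the parallel case — the complement `¬ (K.Nonempty ∧ IsParallelReg …)`, i.e. the oblique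
case together with the empty-container corner (refinement `rest_iff_oblique_empty`). -/
def CoolShadowLinearChartRestP (ϑc ϑp r q rsh rm σ ϑr Rs ε rI ℓ aHi Λ θ s R₁ RC η : ℝ) : Prop :=
  CoolShadowLinearChartUnderP (fun S K Ψ L' w' U t => ¬ (K.Nonempty ∧ IsParallelReg ε r ℓ S K Ψ L' w' U t))
    ϑc ϑp r q rsh rm σ ϑr Rs ε rI ℓ aHi Λ θ s R₁ RC η

/-- ★ (L2-C⟂) THE OBLIQUE CASE [open]: non-empty container, the registration is NOT parallel (transverse registered planes, or a redundant / degenerate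
parametrisation `(L', w')` of the crystal set for which no sheet-to-layer map `σ` exists). -/
def CoolShadowLinearChartObliqueP (ϑc ϑp r q rsh rm σ ϑr Rs ε rI ℓ aHi Λ θ s R₁ RC η : ℝ) : Prop :=
  CoolShadowLinearChartUnderP (fun S K Ψ L' w' U t => K.Nonempty ∧ ¬ IsParallelReg ε r ℓ S K Ψ L' w' U t)
    ϑc ϑp r q rsh rm σ ϑr Rs ε rI ℓ aHi Λ θ s R₁ RC η

/-- ★ (L2-C∅) THE EMPTY-CONTAINER CORNER [open, over-typed corner of (L2-C): at `K = ∅` the moat, both registration clauses and the target (GL) are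
vacuous, but (L2-C) still asks for an exact `η`-linear chart of the crystal ball]. -/
def CoolShadowLinearChartEmptyP (ϑc ϑp r q rsh rm σ ϑr Rs ε rI ℓ aHi Λ θ s R₁ RC η : ℝ) : Prop :=
  CoolShadowLinearChartUnderP (fun _ K _ _ _ _ _ => K = ∅) ϑc ϑp r q rsh rm σ ϑr Rs ε rI ℓ aHi Λ θ s R₁ RC η

/-! ### ZP-2  Junction, equivalence, monotonicity -/

/-- ★★ **JUNCTION (PROVED)**: (L2-C) ⟸ (L2-C∥) ∧ (L2-C∦). [this file] -/
theorem coolShadowLinearChartP_of_parallel_rest {ϑc ϑp r q rsh rm σ ϑr Rs ε rI ℓ aHi Λ θ s R₁ RC η : ℝ}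
    (hP : CoolShadowLinearChartParallelP ϑc ϑp r q rsh rm σ ϑr Rs ε rI ℓ aHi Λ θ s R₁ RC η)
    (hR : CoolShadowLinearChartRestP ϑc ϑp r q rsh rm σ ϑr Rs ε rI ℓ aHi Λ θ s R₁ RC η) :
    CoolShadowLinearChartP ϑc ϑp r q rsh rm σ ϑr Rs ε rI ℓ aHi Λ θ s R₁ RC η := by
  intro δ hδ a ha S hSd hsum hgood L w hL x₀ K hKS hKq hTp hTc L' w' U t hcr Ψ τ hΨ hsurj
  by_cases h : K.Nonempty ∧ IsParallelReg ε r ℓ S K Ψ L' w' U t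
  · exact hP δ hδ a ha S hSd hsum hgood L w hL x₀ K hKS hKq hTp hTc L' w' U t hcr Ψ τ hΨ hsurj h
  · exact hR δ hδ a ha S hSd hsum hgood L w hL x₀ K hKS hKq hTp hTc L' w' U t hcr Ψ τ hΨ hsurj h

/-- ★ REFINEMENT (PROVED): (L2-C∦) ⟸ (L2-C⟂) ∧ (L2-C∅). [this file] -/
theorem rest_of_oblique_empty {ϑc ϑp r q rsh rm σ ϑr Rs ε rI ℓ aHi Λ θ s R₁ RC η : ℝ}
    (hO : CoolShadowLinearChartObliqueP ϑc ϑp r q rsh rm σ ϑr Rs ε rI ℓ aHi Λ θ s R₁ RC η)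
    (hE : CoolShadowLinearChartEmptyP ϑc ϑp r q rsh rm σ ϑr Rs ε rI ℓ aHi Λ θ s R₁ RC η) :
    CoolShadowLinearChartRestP ϑc ϑp r q rsh rm σ ϑr Rs ε rI ℓ aHi Λ θ s R₁ RC η := by
  intro δ hδ a ha S hSd hsum hgood L w hL x₀ K hKS hKq hTp hTc L' w' U t hcr Ψ τ hΨ hsurj h
  by_cases hK : K = ∅
  · exact hE δ hδ a ha S hSd hsum hgood L w hL x₀ K hKS hKq hTp hTc L' w' U t hcr Ψ τ hΨ hsurj hK
  · have hne : K.Nonempty := Set.nonempty_iff_ne_empty.2 hK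
    exact hO δ hδ a ha S hSd hsum hgood L w hL x₀ K hKS hKq hTp hTc L' w' U t hcr Ψ τ hΨ hsurj ⟨hne, fun hpar => h ⟨hne, hpar⟩⟩

/-- JUNCTION in three pieces (PROVED): (L2-C) ⟸ (L2-C∥) ∧ (L2-C⟂) ∧ (L2-C∅). [this file] -/
theorem coolShadowLinearChartP_of_cases {ϑc ϑp r q rsh rm σ ϑr Rs ε rI ℓ aHi Λ θ s R₁ RC η : ℝ}
    (hP : CoolShadowLinearChartParallelP ϑc ϑp r q rsh rm σ ϑr Rs ε rI ℓ aHi Λ θ s R₁ RC η)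
    (hO : CoolShadowLinearChartObliqueP ϑc ϑp r q rsh rm σ ϑr Rs ε rI ℓ aHi Λ θ s R₁ RC η)
    (hE : CoolShadowLinearChartEmptyP ϑc ϑp r q rsh rm σ ϑr Rs ε rI ℓ aHi Λ θ s R₁ RC η) :
    CoolShadowLinearChartP ϑc ϑp r q rsh rm σ ϑr Rs ε rI ℓ aHi Λ θ s R₁ RC η :=
  coolShadowLinearChartP_of_parallel_rest hP (rest_of_oblique_empty hO hE)

/-- each case is a specialisation of (L2-C). [formal bookkeeping] -/
theorem under_of_coolShadowLinearChartP {ϑc ϑp r q rsh rm σ ϑr Rs ε rI ℓ aHi Λ θ s R₁ RC η : ℝ}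
    (P : Set E3 → Set E3 → (ℤ × ℤ × ℤ → E3) → (E3 →L[ℝ] E3) → (ℤ → E3) → (E3 ≃ₗᵢ[ℝ] E3) → E3 → Prop)
    (h : CoolShadowLinearChartP ϑc ϑp r q rsh rm σ ϑr Rs ε rI ℓ aHi Λ θ s R₁ RC η) :
    CoolShadowLinearChartUnderP P ϑc ϑp r q rsh rm σ ϑr Rs ε rI ℓ aHi Λ θ s R₁ RC η :=
  fun δ hδ a ha S hSd hsum hgood L w hL x₀ K hKS hKq hTp hTc L' w' U t hcr Ψ τ hΨ hsurj _ =>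
    h δ hδ a ha S hSd hsum hgood L w hL x₀ K hKS hKq hTp hTc L' w' U t hcr Ψ τ hΨ hsurj

/-- a case piece under a weaker case hypothesis gives the piece under a stronger one. [formal bookkeeping] -/
theorem under_mono_case {ϑc ϑp r q rsh rm σ ϑr Rs ε rI ℓ aHi Λ θ s R₁ RC η : ℝ}
    {P Q : Set E3 → Set E3 → (ℤ × ℤ × ℤ → E3) → (E3 →L[ℝ] E3) → (ℤ → E3) → (E3 ≃ₗᵢ[ℝ] E3) → E3 → Prop}
    (hPQ : ∀ S K Ψ L' w' U t, Q S K Ψ L' w' U t → P S K Ψ L' w' U t)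
    (h : CoolShadowLinearChartUnderP P ϑc ϑp r q rsh rm σ ϑr Rs ε rI ℓ aHi Λ θ s R₁ RC η) :
    CoolShadowLinearChartUnderP Q ϑc ϑp r q rsh rm σ ϑr Rs ε rI ℓ aHi Λ θ s R₁ RC η :=
  fun δ hδ a ha S hSd hsum hgood L w hL x₀ K hKS hKq hTp hTc L' w' U t hcr Ψ τ hΨ hsurj hQ =>
    h δ hδ a ha S hSd hsum hgood L w hL x₀ K hKS hKq hTp hTc L' w' U t hcr Ψ τ hΨ hsurj (hPQ S K Ψ L' w' U t hQ)

/-- ★★ THE EQUIV LAYER OF NODE 79: (L2-C) ⟺ (L2-C∥) ∧ (L2-C∦). [this file] -/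
theorem coolShadowLinearChartP_iff_parallel_rest (ϑc ϑp r q rsh rm σ ϑr Rs ε rI ℓ aHi Λ θ s R₁ RC η : ℝ) :
    CoolShadowLinearChartP ϑc ϑp r q rsh rm σ ϑr Rs ε rI ℓ aHi Λ θ s R₁ RC η ↔
      CoolShadowLinearChartParallelP ϑc ϑp r q rsh rm σ ϑr Rs ε rI ℓ aHi Λ θ s R₁ RC η ∧
        CoolShadowLinearChartRestP ϑc ϑp r q rsh rm σ ϑr Rs ε rI ℓ aHi Λ θ s R₁ RC η :=
  ⟨fun h => ⟨under_of_coolShadowLinearChartP _ h, under_of_coolShadowLinearChartP _ h⟩,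
    fun h => coolShadowLinearChartP_of_parallel_rest h.1 h.2⟩

/-- ★ THE REFINEMENT BENEATH: (L2-C∦) ⟺ (L2-C⟂) ∧ (L2-C∅). [this file] -/
theorem rest_iff_oblique_empty (ϑc ϑp r q rsh rm σ ϑr Rs ε rI ℓ aHi Λ θ s R₁ RC η : ℝ) :
    CoolShadowLinearChartRestP ϑc ϑp r q rsh rm σ ϑr Rs ε rI ℓ aHi Λ θ s R₁ RC η ↔
      CoolShadowLinearChartObliqueP ϑc ϑp r q rsh rm σ ϑr Rs ε rI ℓ aHi Λ θ s R₁ RC η ∧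
        CoolShadowLinearChartEmptyP ϑc ϑp r q rsh rm σ ϑr Rs ε rI ℓ aHi Λ θ s R₁ RC η :=
  ⟨fun h =>
      ⟨under_mono_case (fun S K Ψ L' w' U t (hQ : K.Nonempty ∧ ¬ IsParallelReg ε r ℓ S K Ψ L' w' U t)
          (hP : K.Nonempty ∧ IsParallelReg ε r ℓ S K Ψ L' w' U t) => hQ.2 hP.2) h,
        under_mono_case (fun S K Ψ L' w' U t (hQ : K = ∅) (hP : K.Nonempty ∧ IsParallelReg ε r ℓ S K Ψ L' w' U t) =>
          Set.nonempty_iff_ne_empty.1 hP.1 hQ) h⟩,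
    fun h => rest_of_oblique_empty h.1 h.2⟩

/-- EQUIV in three pieces: (L2-C) ⟺ (L2-C∥) ∧ (L2-C⟂) ∧ (L2-C∅). [this file] -/
theorem coolShadowLinearChartP_cases_iff (ϑc ϑp r q rsh rm σ ϑr Rs ε rI ℓ aHi Λ θ s R₁ RC η : ℝ) :
    CoolShadowLinearChartP ϑc ϑp r q rsh rm σ ϑr Rs ε rI ℓ aHi Λ θ s R₁ RC η ↔
      CoolShadowLinearChartParallelP ϑc ϑp r q rsh rm σ ϑr Rs ε rI ℓ aHi Λ θ s R₁ RC η ∧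
        CoolShadowLinearChartObliqueP ϑc ϑp r q rsh rm σ ϑr Rs ε rI ℓ aHi Λ θ s R₁ RC η ∧
          CoolShadowLinearChartEmptyP ϑc ϑp r q rsh rm σ ϑr Rs ε rI ℓ aHi Λ θ s R₁ RC η :=
  ⟨fun h => ⟨under_of_coolShadowLinearChartP _ h, under_of_coolShadowLinearChartP _ h, under_of_coolShadowLinearChartP _ h⟩,
    fun h => coolShadowLinearChartP_of_cases h.1 h.2.1 h.2.2⟩

/-- the conclusion is monotone: smaller chart radius, larger wiggle. [formal bookkeeping] -/
theorem linChartConcl_mono {ε r ℓ R₁ RC RC' η η' : ℝ} (hRC : RC' ≤ RC) (hη : η ≤ η') {S K : Set E3} {x₀ : E3} {Ψ : ℤ × ℤ × ℤ → E3}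
    {L' : E3 →L[ℝ] E3} {w' : ℤ → E3} {U : E3 ≃ₗᵢ[ℝ] E3} {t : E3} (h : LinChartConcl ε r ℓ R₁ RC η S K x₀ Ψ L' w' U t) :
    LinChartConcl ε r ℓ R₁ RC' η' S K x₀ Ψ L' w' U t := by
  obtain ⟨Ψ', o, b₁, b₂, τ', hch, hcov, hcomp, hwig⟩ := h
  exact ⟨Ψ', o, b₁, b₂, τ', hch.mono (fun y (hy : dist (Ψ' y) x₀ ≤ RC') => hy.trans hRC), fun c hc hd => hcov c hc (hd.trans hRC),
    fun x hx hR y hy hd => hcomp x hx hR y (hy.trans hRC) hd, fun y => (hwig y).trans hη⟩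

/-- a case piece is monotone in `(RC, η)`. [formal bookkeeping] -/
theorem coolShadowLinearChartUnderP_mono
    (P : Set E3 → Set E3 → (ℤ × ℤ × ℤ → E3) → (E3 →L[ℝ] E3) → (ℤ → E3) → (E3 ≃ₗᵢ[ℝ] E3) → E3 → Prop)
    {ϑc ϑp r q rsh rm σ ϑr Rs ε rI ℓ aHi Λ θ s R₁ RC RC' η η' : ℝ} (hRC : RC' ≤ RC) (hη : η ≤ η')
    (h : CoolShadowLinearChartUnderP P ϑc ϑp r q rsh rm σ ϑr Rs ε rI ℓ aHi Λ θ s R₁ RC η) :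
    CoolShadowLinearChartUnderP P ϑc ϑp r q rsh rm σ ϑr Rs ε rI ℓ aHi Λ θ s R₁ RC' η' :=
  fun δ hδ a ha S hSd hsum hgood L w hL x₀ K hKS hKq hTp hTc L' w' U t hcr Ψ τ hΨ hsurj hP =>
    linChartConcl_mono hRC hη (h δ hδ a ha S hSd hsum hgood L w hL x₀ K hKS hKq hTp hTc L' w' U t hcr Ψ τ hΨ hsurj hP)

/-- ★ (L2-C) is MONOTONE in `(RC, η)`: the record (L2-C)(82/5, 33/2, 1/100) of NODE 78 implies every (L2-C)(82/5, RC', η') with `RC' ≤ 33/2`,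
`η' ≥ 1/100`. [this file] -/
theorem coolShadowLinearChartP_mono {ϑc ϑp r q rsh rm σ ϑr Rs ε rI ℓ aHi Λ θ s R₁ RC RC' η η' : ℝ} (hRC : RC' ≤ RC) (hη : η ≤ η')
    (h : CoolShadowLinearChartP ϑc ϑp r q rsh rm σ ϑr Rs ε rI ℓ aHi Λ θ s R₁ RC η) :
    CoolShadowLinearChartP ϑc ϑp r q rsh rm σ ϑr Rs ε rI ℓ aHi Λ θ s R₁ RC' η' :=
  fun δ hδ a ha S hSd hsum hgood L w hL x₀ K hKS hKq hTp hTc L' w' U t hcr Ψ τ hΨ hsurj =>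
    linChartConcl_mono hRC hη (h δ hδ a ha S hSd hsum hgood L w hL x₀ K hKS hKq hTp hTc L' w' U t hcr Ψ τ hΨ hsurj)

/-! ### ZP-3  The parallel case, decided -/

/-- ★★★ **(L2-C∥) THE PARALLEL CASE OF (L2-C), DECIDED (PROVED)** — for every window pair `W₁ < W₂` with the listed margins (crystal separation `σ`, pair
gap `17/16 + 2ϑr`, `Rs ≥ 28/25`): the exact, exactly linear (`η`-linear for every `η ≥ 0`) Barlow bond chart of the cool shadow crystal on the
`RC`-ball, onto, sheet-compatible (parts ZM–ZO: `ParCfg.Hyp.linear_chart`). [this file] -/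
theorem coolShadowLinearChart_parallel {ϑc ϑp r q rsh rm σ ϑr Rs ε rI ℓ aHi Λ θ s R₁ RC η : ℝ} (W₁ W₂ : ℝ) (haHi : aHi ≤ 1) (hε0 : 0 ≤ ε)
    (hη : 0 ≤ η) (hRs : 28 / 25 ≤ Rs) (hϑr : 0 ≤ ϑr) (e1 : 17 / 16 + 2 * ε ≤ 28 / 25) (e3 : 2 * ε < σ) (e4 : 17 / 16 + 2 * ϑr + 2 * ε ≤ 28 / 25)
    (e5 : 17 / 16 + 2 * ϑr < 2 * σ) (z1 : r + q + 17 / 16 < W₁) (z2 : rI + q + ε + (17 / 16 + 2 * ϑr) < W₁) (z3 : q < W₁)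
    (z4 : W₁ + 28 / 25 ≤ W₂) (z6 : W₂ + 17 / 16 + q < ℓ) (z7 : W₂ + ε + (17 / 16 + 2 * ϑr) + q < ℓ) (z9 : RC + ε ≤ W₂) :
    CoolShadowLinearChartParallelP ϑc ϑp r q rsh rm σ ϑr Rs ε rI ℓ aHi Λ θ s R₁ RC η := by
  intro δ hδ a ha S hSd hsum hgood L w hL x₀ K hKS hKq hTp hTc L' w' U t hcr Ψ τ hΨ hsurj hP
  obtain ⟨hKne, σr, hσinj, hpar⟩ := hP
  have hC : Set.range (placedSkel L' w' U t) = placedCrystal L' w' U t := (placedCrystal_eq_range_placedSkel L' w' U t).symm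
  have hG : ParCfg.Hyp ⟨aHi, δ, q, r, rI, ℓ, ε, σ, 17 / 16 + 2 * ϑr, W₁, W₂, RC, S, K, Ψ, τ, x₀, fun m => U.symm (w' m) + t,
      U.symm (L' (triangularVec₁ 1)), U.symm (L' (triangularVec₂ 1)), σr⟩ :=
    { door := hSd
      aHi_le := haHi
      chart := hΨ
      surj := hsurj
      KS := hKS
      Kq := hKq
      Kne := hKne
      sep := by
        show IsSep σ (Set.range (placedSkel L' w' U t))
        rw [hC]; exact isSep_placedCrystal U t hcr.2.1
      gap := by
        show ∀ c ∈ Set.range (placedSkel L' w' U t), ∀ c' ∈ Set.range (placedSkel L' w' U t), dist c c' ≤ 28 / 25 → dist c c' ≤ 17 / 16 + 2 * ϑr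
        rw [hC]; exact fun c hc c' hc' h => placedCrystal_gap hL.2.2.2.1 hcr hRs hϑr hc hc' h
      out := by
        show ∀ p ∈ S, (∃ k ∈ K, dist p k < ℓ) → (∀ k ∈ K, r < dist p k) → ∃ c ∈ Set.range (placedSkel L' w' U t), dist p c ≤ ε
        rw [hC]; exact hcr.2.2.2.1
      inn := by
        show ∀ c ∈ Set.range (placedSkel L' w' U t), (∃ k ∈ K, dist c k < ℓ) → (∀ k ∈ K, rI < dist c k) → ∃ p ∈ S, dist p c ≤ ε
        rw [hC]; exact hcr.2.2.2.2
      σinj := hσinj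
      par := hpar
      ε0 := hε0
      e1 := e1
      e3 := e3
      e4 := by show 17 / 16 + 2 * ϑr + 2 * ε ≤ 28 / 25; exact e4
      e5 := e5
      z1 := z1
      z2 := z2
      z3 := z3
      z4 := z4
      z6 := z6
      z7 := z7
      z9 := z9 }
  obtain ⟨o, b₁, b₂, τ', hch, hcov, hcomp⟩ := hG.linear_chart
  refine ⟨linChart o b₁ b₂, o, b₁, b₂, τ', ?_, ?_, fun x hx _ y _ hd => hcomp x hx y hd, fun y => by rw [dist_self]; exact hη⟩
  · have : ParCfg.C ⟨aHi, δ, q, r, rI, ℓ, ε, σ, 17 / 16 + 2 * ϑr, W₁, W₂, RC, S, K, Ψ, τ, x₀, fun m => U.symm (w' m) + t,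
        U.symm (L' (triangularVec₁ 1)), U.symm (L' (triangularVec₂ 1)), σr⟩ = placedCrystal L' w' U t := hC
    rw [this] at hch
    exact hch
  · intro c hc hd
    rw [← hC] at hc
    exact hcov c hc hd

/-- ★★★ **(L2-C∥) AT THE RECORD NUMERICS (PROVED)**: `ϑp = 1/10, r = 8, q = 4, rsh = 12, rm = 16, σ = 17/20, ϑr = 10⁻⁴, Rs = 5, ε = 10⁻⁴, rI = 10,
ℓ = 43/2, aHi = 1, Λ = 2, θ = 1/16, s = 1/50, R₁ = 82/5`, chart radius `RC = 821/50`, wiggle `η = 1/100` (windows `W₁ = 151/10`, `W₂ = 1643/100`). [this file] -/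
theorem coolShadowLinearChart_parallel_record (ϑc : ℝ) :
    CoolShadowLinearChartParallelP ϑc (1 / 10) 8 4 12 16 (17 / 20) (1 / 10000) 5 (1 / 10000) 10 (43 / 2) 1 2 (1 / 16) (1 / 50)
      (82 / 5) (821 / 50) (1 / 100) :=
  coolShadowLinearChart_parallel (151 / 10) (1643 / 100) (by norm_num) (by norm_num) (by norm_num) (by norm_num) (by norm_num) (by norm_num)
    (by norm_num) (by norm_num) (by norm_num) (by norm_num) (by norm_num) (by norm_num) (by norm_num) (by norm_num) (by norm_num) (by norm_num)

/-- the parallel case at every chart radius `RC ≤ 1643/100 − 10⁻⁴` of the record numerics (so in particular NOT at the record `33/2` of NODE 78: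
the margin `RC + q + ε + 17/16 + 2ϑr < ℓ` is what the proof needs). [formal bookkeeping] -/
theorem coolShadowLinearChart_parallel_record' (ϑc RC η : ℝ) (hRC : RC + 1 / 10000 ≤ 1643 / 100) (hη : 0 ≤ η) :
    CoolShadowLinearChartParallelP ϑc (1 / 10) 8 4 12 16 (17 / 20) (1 / 10000) 5 (1 / 10000) 10 (43 / 2) 1 2 (1 / 16) (1 / 50)
      (82 / 5) RC η :=
  coolShadowLinearChart_parallel (151 / 10) (1643 / 100) (by norm_num) (by norm_num) hη (by norm_num) (by norm_num) (by norm_num)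
    (by norm_num) (by norm_num) (by norm_num) (by norm_num) (by norm_num) (by norm_num) (by norm_num) (by norm_num) (by norm_num) hRC

/-! ### ZP-4  The re-instanced junction of NODE 78 -/

/-- ★★ **(L2-C) AT `RC' = 821/50` FROM THE ONE OPEN PIECE (L2-C∦) (PROVED)**: the parallel case is discharged. [this file] -/
theorem coolShadowLinearChartP_record_of_rest (ϑc : ℝ)
    (hR : CoolShadowLinearChartRestP ϑc (1 / 10) 8 4 12 16 (17 / 20) (1 / 10000) 5 (1 / 10000) 10 (43 / 2) 1 2 (1 / 16) (1 / 50)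
      (82 / 5) (821 / 50) (1 / 100)) :
    CoolShadowLinearChartP ϑc (1 / 10) 8 4 12 16 (17 / 20) (1 / 10000) 5 (1 / 10000) 10 (43 / 2) 1 2 (1 / 16) (1 / 50)
      (82 / 5) (821 / 50) (1 / 100) :=
  coolShadowLinearChartP_of_parallel_rest (coolShadowLinearChart_parallel_record ϑc) hR

/-- ★★ **(L2-C)-LEVEL JUNCTION AT THE RECORD (PROVED)**: (GL) `BondLabelP` ⟸ (L2-S) `DoorChartPinningP … 14 (57/4) (82/5)` [open, NODE 78] ∧ (L2-C∦)
`CoolShadowLinearChartRestP … (82/5) (821/50) (1/100)` [open] — via the general junction `bondLabelP_of_pinning_linearChart` of tree ZK at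
`RC = 821/50 ≥ R₁ + ε`. [this file] -/
theorem bondLabelP_record_of_rest (ϑc : ℝ)
    (hPin : DoorChartPinningP ϑc (1 / 10) 8 4 12 16 (17 / 20) (1 / 10000) 5 (1 / 10000) 10 (43 / 2) 1 2 (1 / 16) (1 / 50)
      14 (57 / 4) (82 / 5))
    (hR : CoolShadowLinearChartRestP ϑc (1 / 10) 8 4 12 16 (17 / 20) (1 / 10000) 5 (1 / 10000) 10 (43 / 2) 1 2 (1 / 16) (1 / 50)
      (82 / 5) (821 / 50) (1 / 100)) :
    BondLabelP ϑc (1 / 10) 8 4 12 16 (17 / 20) (1 / 10000) 5 (1 / 10000) 10 (43 / 2) 1 2 (1 / 16) (1 / 50) :=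
  bondLabelP_of_pinning_linearChart (by norm_num) (by norm_num) (by norm_num) (by norm_num) (by norm_num) (by norm_num) (by norm_num) hPin
    (coolShadowLinearChartP_record_of_rest ϑc hR)

/-- (L2-C) at `RC' = 821/50` from the two refined open pieces (PROVED). [this file] -/
theorem coolShadowLinearChartP_record_of_cases (ϑc : ℝ)
    (hO : CoolShadowLinearChartObliqueP ϑc (1 / 10) 8 4 12 16 (17 / 20) (1 / 10000) 5 (1 / 10000) 10 (43 / 2) 1 2 (1 / 16) (1 / 50)
      (82 / 5) (821 / 50) (1 / 100))
    (hE : CoolShadowLinearChartEmptyP ϑc (1 / 10) 8 4 12 16 (17 / 20) (1 / 10000) 5 (1 / 10000) 10 (43 / 2) 1 2 (1 / 16) (1 / 50)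
      (82 / 5) (821 / 50) (1 / 100)) :
    CoolShadowLinearChartP ϑc (1 / 10) 8 4 12 16 (17 / 20) (1 / 10000) 5 (1 / 10000) 10 (43 / 2) 1 2 (1 / 16) (1 / 50)
      (82 / 5) (821 / 50) (1 / 100) :=
  coolShadowLinearChartP_of_cases (coolShadowLinearChart_parallel_record ϑc) hO hE

/-- NODE 79 junction in three pieces (PROVED): (GL) ⟸ (L2-S) ∧ (L2-C⟂) ∧ (L2-C∅) at the same constants. [this file] -/
theorem bondLabelP_record_of_cases (ϑc : ℝ)
    (hPin : DoorChartPinningP ϑc (1 / 10) 8 4 12 16 (17 / 20) (1 / 10000) 5 (1 / 10000) 10 (43 / 2) 1 2 (1 / 16) (1 / 50)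
      14 (57 / 4) (82 / 5))
    (hO : CoolShadowLinearChartObliqueP ϑc (1 / 10) 8 4 12 16 (17 / 20) (1 / 10000) 5 (1 / 10000) 10 (43 / 2) 1 2 (1 / 16) (1 / 50)
      (82 / 5) (821 / 50) (1 / 100))
    (hE : CoolShadowLinearChartEmptyP ϑc (1 / 10) 8 4 12 16 (17 / 20) (1 / 10000) 5 (1 / 10000) 10 (43 / 2) 1 2 (1 / 16) (1 / 50)
      (82 / 5) (821 / 50) (1 / 100)) :
    BondLabelP ϑc (1 / 10) 8 4 12 16 (17 / 20) (1 / 10000) 5 (1 / 10000) 10 (43 / 2) 1 2 (1 / 16) (1 / 50) :=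
  bondLabelP_of_pinning_linearChart (by norm_num) (by norm_num) (by norm_num) (by norm_num) (by norm_num) (by norm_num) (by norm_num) hPin
    (coolShadowLinearChartP_record_of_cases ϑc hO hE)

/-- the open piece at `RC' = 821/50` follows from the record (L2-C)(82/5, 33/2, 1/100) of NODE 78 (monotonicity) — NODE 79 refines NODE 78, it does
not strengthen it. [formal bookkeeping] -/
theorem rest_record_of_coolShadowLinearChartP_record (ϑc : ℝ)
    (h : CoolShadowLinearChartP ϑc (1 / 10) 8 4 12 16 (17 / 20) (1 / 10000) 5 (1 / 10000) 10 (43 / 2) 1 2 (1 / 16) (1 / 50)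
      (82 / 5) (33 / 2) (1 / 100)) :
    CoolShadowLinearChartRestP ϑc (1 / 10) 8 4 12 16 (17 / 20) (1 / 10000) 5 (1 / 10000) 10 (43 / 2) 1 2 (1 / 16) (1 / 50)
      (82 / 5) (821 / 50) (1 / 100) :=
  under_of_coolShadowLinearChartP _ (coolShadowLinearChartP_mono (RC' := 821 / 50) (η' := 1 / 100) (by norm_num) le_rfl h)

/-- likewise for the refined pieces. [formal bookkeeping] -/
theorem cases_record_of_coolShadowLinearChartP_record (ϑc : ℝ)
    (h : CoolShadowLinearChartP ϑc (1 / 10) 8 4 12 16 (17 / 20) (1 / 10000) 5 (1 / 10000) 10 (43 / 2) 1 2 (1 / 16) (1 / 50)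
      (82 / 5) (33 / 2) (1 / 100)) :
    CoolShadowLinearChartObliqueP ϑc (1 / 10) 8 4 12 16 (17 / 20) (1 / 10000) 5 (1 / 10000) 10 (43 / 2) 1 2 (1 / 16) (1 / 50)
        (82 / 5) (821 / 50) (1 / 100) ∧
      CoolShadowLinearChartEmptyP ϑc (1 / 10) 8 4 12 16 (17 / 20) (1 / 10000) 5 (1 / 10000) 10 (43 / 2) 1 2 (1 / 16) (1 / 50)
        (82 / 5) (821 / 50) (1 / 100) :=
  have h' := coolShadowLinearChartP_mono (RC' := 821 / 50) (η' := 1 / 100) (by norm_num) le_rfl h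
  ⟨under_of_coolShadowLinearChartP _ h', under_of_coolShadowLinearChartP _ h'⟩

end Summit.AtomisticToContinuum.Crystallization.Theorems.ChartedZeroExcessLayeredLatticeLiouville
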